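import Mathlib.Analysis.Calculus.MeanValue
import Mathlib.Analysis.Calculus.ContDiff.Comp
import Mathlib.Analysis.Normed.Module.FiniteDimension
import HarnessLib

/-!
# A UNIFORM second-order expansion in the slice variable, with constants from compactness
# (window datum `j(y) = w₀(1 + ℓ(y) + e(y))` of the quantitative Laplace method — layer (B3) of the DIRECT Laplace road to
# ⟨stmt-QuantumFields-24204⟩ `VirialFluxGap.SharpTwistedLaplace`)

Helper module (free-hands work of width seat ym-line-sfw-p2-w3 g57, cell ym-idea-1; `--supports 24204`).  Pure calculus.  For a real function
`F` on a product `P × Q` which is `C²` on an open set containing `K × closedBall 0 R₁` (`K` compact, `Q` proper):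
* ★ `exists_uniform_taylor_two` — there is ONE constant `C ≥ 0` with
  `|F(z, a) − F(z, 0) − DF(z, 0)·(0, a)| ≤ C‖a‖²` for all `z ∈ K`, `‖a‖ ≤ R₁`
  (mean value inequality twice: `DF` is `M`-Lipschitz along `{z} × [0, a]` with `M = sup ‖D²F‖` on the compact, then the map
  `a ↦ F(z,a) − DF(z,0)(0,a)` has derivative of norm `≤ M‖a‖` along the segment);
* `exists_bound_fderiv` — and ONE constant `D` with `‖DF(z, 0)‖ ≤ D` on `K`.
USE: with `F = anchorDensity` (✓`exists_ball_contDiffAt_anchorDensity`: `C^∞` near the base point) and `K = Φ` the group window, integrating `dz`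
over `Φ` gives the window datum of the transversal density `j` with UNIVERSAL constants `C·vol(Φ)/w₀`, `D·vol(Φ)/w₀` — never computed.
Everything here is PROVED; no definitions, no named facts (namespace `Summit.QuantumFields.YangMills.Theorems.VirialFluxGap.UniformTaylor`).
HONEST FRAMING: calculus; ⟨24204⟩, ⟨24319⟩ and every rung stay OPEN; the Yang–Mills mass gap (Clay) is NOT touched; no summit is proved by a line.

## References
* K. W. Breitung, *Asymptotic Approximations for Probability Integrals*, LNM 1592 (1994), Lemma 7 p. 12 (Taylor remainders in Laplace windows). [Breitung1994]
-/

set_option autoImplicit false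

noncomputable section

open Set Filter Metric Topology

namespace Summit.QuantumFields.YangMills.Theorems.VirialFluxGap.UniformTaylor

variable {P Q : Type*} [NormedAddCommGroup P] [NormedSpace ℝ P] [NormedAddCommGroup Q] [NormedSpace ℝ Q] [ProperSpace Q]

omit [NormedSpace ℝ P] [NormedSpace ℝ Q] [ProperSpace Q] in
/-- `‖(0, a)‖ = ‖a‖` in the product (sup) norm. [folklore] -/
theorem norm_zero_prod (a : Q) : ‖((0 : P), a)‖ = ‖a‖ := by
  simp [Prod.norm_def]

omit [ProperSpace Q] in
/-- **One constant bounds `DF(z, 0)` on a compact `K`** (continuity of `DF` on the open set of smoothness). [folklore] -/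
theorem exists_bound_fderiv {F : P × Q → ℝ} {U : Set (P × Q)} (hU : IsOpen U) (hF : ContDiffOn ℝ 2 F U) {K : Set P}
    (hK : IsCompact K) (hKU : ∀ z ∈ K, (z, (0 : Q)) ∈ U) :
    ∃ D : ℝ, 0 ≤ D ∧ ∀ z ∈ K, ‖fderiv ℝ F (z, 0)‖ ≤ D := by
  have hcont : ContinuousOn (fun z : P => fderiv ℝ F (z, 0)) K := by
    refine continuousOn_of_forall_continuousAt fun z hz => ?_
    have h2 : ContDiffAt ℝ 2 F (z, 0) := hF.contDiffAt (hU.mem_nhds (hKU z hz))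
    have h1 : ContDiffAt ℝ 1 (fderiv ℝ F) (z, 0) := h2.fderiv_right le_rfl
    have hz' : ContinuousAt (fun z' : P => (z', (0 : Q))) z := (continuous_id.prodMk continuous_const).continuousAt
    exact ContinuousAt.comp (g := fderiv ℝ F) (f := fun z' : P => (z', (0 : Q))) (x := z) h1.continuousAt hz'
  obtain ⟨D, hD⟩ := hK.exists_bound_of_continuousOn hcont
  exact ⟨max D 0, le_max_right _ _, fun z hz => (hD z hz).trans (le_max_left _ _)⟩

/-- ★ **UNIFORM SECOND-ORDER EXPANSION IN THE SLICE VARIABLE.**  If `F : P × Q → ℝ` is `C²` on an open `U ⊇ K × closedBall 0 R₁` with `K`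
compact, there is `C ≥ 0` with `|F(z,a) − F(z,0) − DF(z,0)(0,a)| ≤ C‖a‖²` for all `z ∈ K`, `‖a‖ ≤ R₁`. [cite: Breitung1994, Lemma 7 p. 12] -/
theorem exists_uniform_taylor_two {F : P × Q → ℝ} {U : Set (P × Q)} (hU : IsOpen U) (hF : ContDiffOn ℝ 2 F U) {K : Set P}
    (hK : IsCompact K) {R₁ : ℝ} (hKU : K ×ˢ closedBall (0 : Q) R₁ ⊆ U) :
    ∃ C : ℝ, 0 ≤ C ∧ ∀ z ∈ K, ∀ a ∈ closedBall (0 : Q) R₁,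
      |F (z, a) - F (z, 0) - fderiv ℝ F (z, 0) ((0 : P), a)| ≤ C * ‖a‖ ^ 2 := by
  -- smoothness data at the points of `U`
  have hD1 : ∀ w ∈ U, HasFDerivAt F (fderiv ℝ F w) w := fun w hw =>
    ((hF.contDiffAt (hU.mem_nhds hw)).differentiableAt (by norm_num)).hasFDerivAt
  have hD2 : ∀ w ∈ U, HasFDerivAt (fderiv ℝ F) (fderiv ℝ (fderiv ℝ F) w) w := fun w hw =>
    (((hF.contDiffAt (hU.mem_nhds hw)).fderiv_right (m := 1) le_rfl).differentiableAt one_ne_zero).hasFDerivAt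
  -- `M = sup ‖D²F‖` on the compact
  have hcomp : IsCompact (K ×ˢ closedBall (0 : Q) R₁) := hK.prod (isCompact_closedBall 0 R₁)
  have hcont2 : ContinuousOn (fun w => ‖fderiv ℝ (fderiv ℝ F) w‖) (K ×ˢ closedBall (0 : Q) R₁) := by
    refine continuousOn_of_forall_continuousAt fun w hw => ?_
    have h2 : ContDiffAt ℝ 2 F w := hF.contDiffAt (hU.mem_nhds (hKU hw))
    have h1 : ContDiffAt ℝ 1 (fderiv ℝ F) w := h2.fderiv_right le_rfl
    have h0 : ContDiffAt ℝ 0 (fderiv ℝ (fderiv ℝ F)) w := h1.fderiv_right le_rfl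
    exact (continuous_norm (E := P × Q →L[ℝ] (P × Q →L[ℝ] ℝ))).continuousAt.comp h0.continuousAt
  obtain ⟨M₀, hM₀⟩ := hcomp.exists_bound_of_continuousOn hcont2
  set M := max M₀ 0 with hM
  have hM0 : 0 ≤ M := le_max_right _ _
  have hMb : ∀ w ∈ K ×ˢ closedBall (0 : Q) R₁, ‖fderiv ℝ (fderiv ℝ F) w‖ ≤ M := fun w hw => by
    have h := hM₀ w hw
    rw [Real.norm_eq_abs] at h
    exact ((le_abs_self _).trans h).trans (le_max_left _ _)
  refine ⟨M, hM0, fun z hz a ha => ?_⟩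
  have ha' : ‖a‖ ≤ R₁ := mem_closedBall_zero_iff.1 ha
  -- the slice `S = {z} × closedBall 0 ‖a‖` is convex and sits in the compact
  set S : Set (P × Q) := ({z} : Set P) ×ˢ closedBall (0 : Q) ‖a‖ with hS
  have hSconv : Convex ℝ S := (convex_singleton z).prod (convex_closedBall 0 ‖a‖)
  have hSsub : S ⊆ K ×ˢ closedBall (0 : Q) R₁ := by
    rintro ⟨z', a'⟩ ⟨hz', ha''⟩
    rw [mem_singleton_iff] at hz'
    subst hz'
    exact ⟨hz, mem_closedBall_zero_iff.2 ((mem_closedBall_zero_iff.1 ha'').trans ha')⟩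
  have hSU : S ⊆ U := hSsub.trans hKU
  have hz0 : (z, (0 : Q)) ∈ S := ⟨mem_singleton z, mem_closedBall_zero_iff.2 (by simp)⟩
  have hza : (z, a) ∈ S := ⟨mem_singleton z, mem_closedBall_zero_iff.2 le_rfl⟩
  -- step 1: `DF` is `M`-Lipschitz on `S` from the base point
  have hLip : ∀ w ∈ S, ‖fderiv ℝ F w - fderiv ℝ F (z, 0)‖ ≤ M * ‖a‖ := by
    intro w hw
    have h := hSconv.norm_image_sub_le_of_norm_hasFDerivWithin_le (f := fderiv ℝ F) (f' := fun w => fderiv ℝ (fderiv ℝ F) w)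
      (fun w hw => (hD2 w (hSU hw)).hasFDerivWithinAt) (fun w hw => hMb w (hSsub hw)) hz0 hw
    refine h.trans (mul_le_mul_of_nonneg_left ?_ hM0)
    obtain ⟨hw1, hw2⟩ := hw
    rw [mem_singleton_iff] at hw1
    have : w - (z, 0) = ((0 : P), w.2) := by ext <;> simp [hw1]
    rw [this, norm_zero_prod]
    exact mem_closedBall_zero_iff.1 hw2
  -- step 2: the map `g(w) = F w − DF(z,0) w` has small derivative on `S`
  set L := fderiv ℝ F (z, 0) with hL
  have hg : ∀ w ∈ S, HasFDerivWithinAt (fun w => F w - L w) (fderiv ℝ F w - L) S w := fun w hw =>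
    ((hD1 w (hSU hw)).sub L.hasFDerivAt).hasFDerivWithinAt
  have h := hSconv.norm_image_sub_le_of_norm_hasFDerivWithin_le hg hLip hz0 hza
  have hsub : (z, a) - (z, (0 : Q)) = ((0 : P), a) := by ext <;> simp
  rw [hsub, norm_zero_prod] at h
  have hlin : L (z, a) - L (z, 0) = L ((0 : P), a) := by rw [← map_sub, hsub]
  have hexpr : F (z, a) - F (z, 0) - L ((0 : P), a) = (F (z, a) - L (z, a)) - (F (z, 0) - L (z, 0)) := by rw [← hlin]; ring
  rw [hexpr, ← Real.norm_eq_abs]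
  calc ‖F (z, a) - L (z, a) - (F (z, 0) - L (z, 0))‖ ≤ M * ‖a‖ * ‖a‖ := h
    _ = M * ‖a‖ ^ 2 := by ring

end Summit.QuantumFields.YangMills.Theorems.VirialFluxGap.UniformTaylor

end
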